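import Mathlib
import HarnessLib
import Summits.Ventures.LatticeQCDFlow.Scaling.WilsonIdentityFlowLaw
import Summits.Ventures.LatticeQCDFlow.Scaling.U1IdentityFlowVolumeLaw

/-!
# LatticeQCDFlow / Scaling — the STRONG-COUPLING law of the untrained sampler: as `β → 0`,
# `(1 − Z(β)²/Z(2β))/β² → Var_μ(T)` and `(1 − Z(β/2)²/Z(β))/β² → Var_μ(T)/4` for every tilt family;
# U(1) plaquettes: `(1 − I₀(β)²/I₀(2β))/β² → ½`, `(1 − I₀(β/2)²/I₀(β))/β² → ⅛`; Wilson: `Var_Haar(S)`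

HONEST FRAMING: exact (Metropolis-corrected) sampling algorithms for lattice gauge theory;
figures of merit are autocorrelation/cost numbers at stated couplings and volumes; no
continuum-physics claim.

Venture `LatticeQCDFlow` (cell pub-lqcd), topic `Scaling`; FANOUT row 3 (`s0-u1-a`, S0-B
implementation A, GEN-16).  NEW WORK of the cell (elementary calculus on Mathlib's analytic cumulant
generating function), not a published result; NO definition is introduced.  For a probability
reference law `μ` and a tilt `e^{βT}μ/Z(β)` with all exponential moments (`Z = mgf T μ`), the ESS
`Z(β)²/Z(2β) = exp(2·cgf(β) − cgf(2β))` and the Bhattacharyya ceiling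
`Z(β/2)²/Z(β) = exp(2·cgf(β/2) − cgf(β))` have vanishing first and known second derivative at
`β = 0` (`cgf'' (0) = Var_μ(T)`, Mathlib `variance_tilted_mul`), so one l'Hôpital step gives the
quadratic law at strong coupling (value-free; the companion of row 3's weak-coupling files):

* §1 **`tendsto_div_sq_of_hasDerivAt`** — if `h(0) = 0`, `h'(0) = 0` and `h'` has derivative `c`
  at `0`, then `h(t)/t² → c/2` as `t → 0` (`t ≠ 0`);
* §2 any tilt family: `hasDerivAt_cgf`, `hasDerivAt_deriv_cgf`, `iteratedDeriv_two_cgf_zero`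
  (`= Var_μ(T)`); **`tendsto_one_sub_mgf_sq_div_double_div_sq`**
  `(1 − Z(β)²/Z(2β))/β² → Var_μ(T)` and **`tendsto_one_sub_mgf_half_sq_div_div_sq`**
  `(1 − Z(β/2)²/Z(β))/β² → Var_μ(T)/4`;
* §3 U(1) (`μ = (2π)⁻¹dθ` on `(0, 2π]`, `T = cos`, `Z = I₀`, `Var(cos) = ½`):
  **`tendsto_one_sub_besselI_sq_div_double_div_sq`** `(1 − I₀(β)²/I₀(2β))/β² → ½` and
  **`tendsto_one_sub_besselI_half_sq_div_div_sq`** `(1 − I₀(β/2)²/I₀(β))/β² → ⅛`;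
* §4 Wilson, product Haar (`T = −S`): **`wilsonIdentityFlow_one_sub_essFrac_div_sq_tendsto`**
  `(1 − Z(β)²/Z(2β))/β² → Var_Haar(S)` and **`wilsonIdentityFlow_one_sub_bhattSq_div_sq_tendsto`**
  `(1 − Z(β/2)²/Z(β))/β² → Var_Haar(S)/4` (`Z = (partitionFunction ρ ·).toReal`).

Reading (value-free; no number of ours is computed or implied): at strong coupling the untrained
exact sampler is nearly perfect, with an ESS deficit `Var_μ(T)·β² + o(β²)` and an acceptance-ceiling
deficit a quarter of it; per U(1) plaquette the coefficients are `½` and `⅛`.  NOT CLAIMED: the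
acceptance itself to second order (it sits between `(8/9)·ESS` and the ceiling, so only its ceiling
deficit `≥ β²Var/4·(1 + o(1))` follows); uniformity in the volume; any value at the cell's `(β, L)`;
nothing re-scored, SEALED.md untouched.
-/

noncomputable section

namespace Summit.Ventures.LatticeQCDFlow.Theory2

open MeasureTheory Real Set Filter Topology ProbabilityTheory
open Literature.Analysis.FunctionSpaces (besselI besselI_zero_pos)
open Summit.Ventures.LatticeQCDFlow.Scoring (onePlaquetteZ onePlaquetteZ_pos onePlaquetteZ_eq_besselI)

/-! ## §1 One l'Hôpital step -/

section RealVariable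

/-- **`h(t)/t² → c/2`** when `h` is differentiable near `0` with `h(0) = 0`, `h'(0) = 0` and `h'`
has derivative `c` at `0`. [folklore] -/
theorem tendsto_div_sq_of_hasDerivAt {h h' : ℝ → ℝ} {c : ℝ}
    (hh : ∀ᶠ x in 𝓝 (0 : ℝ), HasDerivAt h (h' x) x) (h0 : h 0 = 0) (h'0 : h' 0 = 0)
    (hh' : HasDerivAt h' c 0) :
    Tendsto (fun t : ℝ => h t / t ^ 2) (𝓝[≠] 0) (𝓝 (c / 2)) := by
  have hcont : ContinuousAt h 0 := hh.self_of_nhds.continuousAt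
  refine HasDerivAt.lhopital_zero_nhdsNE (f' := h') (g' := fun t => 2 * t)
    (hh.filter_mono nhdsWithin_le_nhds) ?_ ?_ ?_ ?_ ?_
  · exact Eventually.of_forall fun x => by simpa using hasDerivAt_pow 2 x
  · filter_upwards [self_mem_nhdsWithin] with x hx
    exact mul_ne_zero two_ne_zero hx
  · have := hcont.tendsto
    rw [h0] at this
    exact this.mono_left nhdsWithin_le_nhds
  · have : Tendsto (fun t : ℝ => t ^ 2) (𝓝 0) (𝓝 0) := by
      simpa using (continuous_pow 2).tendsto (0 : ℝ)
    exact this.mono_left nhdsWithin_le_nhds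
  · have hs := hasDerivAt_iff_tendsto_slope_zero.1 hh'
    simp only [zero_add, h'0, sub_zero, smul_eq_mul] at hs
    have h2 := hs.const_mul (1 / 2)
    rw [show (1 : ℝ) / 2 * c = c / 2 by ring] at h2
    exact h2.congr fun t => by ring

end RealVariable

/-! ## §2 Any tilt family: the second derivative of `log Z` at `0` is the variance -/

section Tilt

variable {Ω : Type*} [MeasurableSpace Ω] {μ : Measure Ω} [IsProbabilityMeasure μ] {T : Ω → ℝ}

omit [IsProbabilityMeasure μ] in
/-- All exponential moments ⇒ every real is interior to `integrableExpSet`. [folklore] -/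
theorem mem_interior_integrableExpSet_of_forall
    (hint : ∀ t, Integrable (fun ω => Real.exp (t * T ω)) μ) (v : ℝ) :
    v ∈ interior (integrableExpSet T μ) := by
  rw [show integrableExpSet T μ = univ from eq_univ_of_forall hint, interior_univ]; trivial

omit [IsProbabilityMeasure μ] in
/-- `cgf` is differentiable everywhere, with derivative `deriv cgf`. [folklore] -/
theorem hasDerivAt_cgf (hint : ∀ t, Integrable (fun ω => Real.exp (t * T ω)) μ) (v : ℝ) :
    HasDerivAt (cgf T μ) (deriv (cgf T μ) v) v :=
  (analyticAt_cgf (mem_interior_integrableExpSet_of_forall hint v)).differentiableAt.hasDerivAt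

omit [IsProbabilityMeasure μ] in
/-- `deriv cgf` is differentiable everywhere, with derivative `iteratedDeriv 2 cgf`. [folklore] -/
theorem hasDerivAt_deriv_cgf (hint : ∀ t, Integrable (fun ω => Real.exp (t * T ω)) μ) (v : ℝ) :
    HasDerivAt (deriv (cgf T μ)) (iteratedDeriv 2 (cgf T μ) v) v := by
  rw [iteratedDeriv_succ, iteratedDeriv_one]
  exact (analyticAt_cgf (mem_interior_integrableExpSet_of_forall hint v)).deriv.differentiableAt
    |>.hasDerivAt

/-- **`(log Z)''(0) = Var_μ(T)`** (Mathlib's `variance_tilted_mul` at `t = 0`). [folklore] -/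
theorem iteratedDeriv_two_cgf_zero (hint : ∀ t, Integrable (fun ω => Real.exp (t * T ω)) μ) :
    iteratedDeriv 2 (cgf T μ) 0 = Var[T; μ] := by
  rw [← variance_tilted_mul (mem_interior_integrableExpSet_of_forall hint 0)]
  have : (fun ω => (0 : ℝ) * T ω) = 0 := by funext ω; simp
  rw [this, tilted_zero]

/-- The ESS ratio is `exp` of a second difference of `cgf`. [folklore] -/
theorem mgf_sq_div_double_eq_exp (hint : ∀ t, Integrable (fun ω => Real.exp (t * T ω)) μ) (β : ℝ) :
    mgf T μ β ^ 2 / mgf T μ (2 * β) = Real.exp (2 * cgf T μ β - cgf T μ (2 * β)) := by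
  rw [← exp_cgf (hint β), ← exp_cgf (hint (2 * β)), sq, ← Real.exp_add, ← Real.exp_sub]
  congr 1
  ring

/-- The Bhattacharyya-ceiling ratio is `exp` of a second difference of `cgf`. [folklore] -/
theorem mgf_half_sq_div_eq_exp (hint : ∀ t, Integrable (fun ω => Real.exp (t * T ω)) μ) (β : ℝ) :
    mgf T μ (β / 2) ^ 2 / mgf T μ β = Real.exp (2 * cgf T μ (β / 2) - cgf T μ β) := by
  have h := mgf_sq_div_double_eq_exp hint (β / 2)
  rwa [mul_div_cancel₀ _ (two_ne_zero' ℝ)] at h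

/-- **STRONG COUPLING, ESS**: `(1 − Z(β)²/Z(2β))/β² → Var_μ(T)` as `β → 0`. [ours] -/
theorem tendsto_one_sub_mgf_sq_div_double_div_sq
    (hint : ∀ t, Integrable (fun ω => Real.exp (t * T ω)) μ) :
    Tendsto (fun β : ℝ => (1 - mgf T μ β ^ 2 / mgf T μ (2 * β)) / β ^ 2) (𝓝[≠] 0)
      (𝓝 (Var[T; μ])) := by
  simp_rw [mgf_sq_div_double_eq_exp hint]
  -- `g β = 2 cgf β − cgf(2β)`, `h β = 1 − e^{g β}`
  set L := cgf T μ with hL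
  have hLd := hasDerivAt_cgf hint
  have hg : ∀ x, HasDerivAt (fun β => 2 * L β - L (2 * β))
      (2 * deriv L x - deriv L (2 * x) * 2) x := fun x => by
    have h2 : HasDerivAt (fun β => L (2 * β)) (deriv L (2 * x) * 2) x := by
      have := (hLd (2 * x)).comp x ((hasDerivAt_id x).const_mul 2)
      simpa [Function.comp_def] using this
    exact ((hLd x).const_mul 2).sub h2
  have hh : ∀ x, HasDerivAt (fun β => 1 - Real.exp (2 * L β - L (2 * β)))
      (-(Real.exp (2 * L x - L (2 * x)) * (2 * deriv L x - deriv L (2 * x) * 2))) x := fun x =>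
    ((hg x).exp.const_sub 1)
  have key := tendsto_div_sq_of_hasDerivAt (c := 2 * Var[T; μ]) (Eventually.of_forall hh) ?_ ?_ ?_
  · simpa using key
  · simp [hL, cgf_zero]
  · simp only [mul_zero]; ring
  · -- derivative of `h'` at `0`: product rule, `g(0) = 0`, `g'(0) = 0`, `g''(0) = −2 Var`
    have hLdd := hasDerivAt_deriv_cgf hint
    have hg' : HasDerivAt (fun x => 2 * deriv L x - deriv L (2 * x) * 2)
        (2 * iteratedDeriv 2 L 0 - iteratedDeriv 2 L (2 * 0) * 2 * 2) 0 := by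
      have h2 : HasDerivAt (fun x => deriv L (2 * x)) (iteratedDeriv 2 L (2 * 0) * 2) 0 := by
        have := (hLdd (2 * 0)).comp 0 ((hasDerivAt_id (0 : ℝ)).const_mul 2)
        simpa [Function.comp_def] using this
      exact ((hLdd 0).const_mul 2).sub (h2.mul_const 2)
    have hprod := ((hg 0).exp.mul hg').neg
    refine hprod.congr_deriv ?_
    simp only [mul_zero, hL, cgf_zero, sub_self, Real.exp_zero, one_mul]
    rw [iteratedDeriv_two_cgf_zero hint]
    ring

/-- **STRONG COUPLING, CEILING**: `(1 − Z(β/2)²/Z(β))/β² → Var_μ(T)/4` as `β → 0`. [ours] -/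
theorem tendsto_one_sub_mgf_half_sq_div_div_sq
    (hint : ∀ t, Integrable (fun ω => Real.exp (t * T ω)) μ) :
    Tendsto (fun β : ℝ => (1 - mgf T μ (β / 2) ^ 2 / mgf T μ β) / β ^ 2) (𝓝[≠] 0)
      (𝓝 (Var[T; μ] / 4)) := by
  -- substitute `β = 2γ`: `(1 − Z(γ)²/Z(2γ))/(2γ)² = (1/4)·(…)/γ²`
  have h := (tendsto_one_sub_mgf_sq_div_double_div_sq hint).comp
    (show Tendsto (fun β : ℝ => β / 2) (𝓝[≠] 0) (𝓝[≠] 0) from by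
      refine tendsto_nhdsWithin_of_tendsto_nhds_of_eventually_within _ ?_ ?_
      · have h0 : Tendsto (fun β : ℝ => β / 2) (𝓝 0) (𝓝 0) := by
          simpa using ((continuous_id.div_const (2 : ℝ)).tendsto (0 : ℝ))
        exact h0.mono_left nhdsWithin_le_nhds
      · filter_upwards [self_mem_nhdsWithin] with x hx
        exact div_ne_zero hx two_ne_zero)
  have e : ∀ β : ℝ, (1 - mgf T μ (β / 2) ^ 2 / mgf T μ β) / β ^ 2
      = (1 / 4) * ((1 - mgf T μ (β / 2) ^ 2 / mgf T μ (2 * (β / 2))) / (β / 2) ^ 2) := by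
    intro β
    rw [mul_div_cancel₀ _ (two_ne_zero' ℝ)]
    field_simp
    ring
  simp_rw [e]
  have := h.const_mul (1 / 4 : ℝ)
  simpa [div_eq_inv_mul, Function.comp_def] using this

end Tilt

/-! ## §3 U(1) plaquettes: `Var(cos) = ½` under the uniform law -/

section U1

/-- The uniform probability law `(2π)⁻¹ dθ` on `(0, 2π]` makes `I₀(β)` the moment generating
function of `cos`. [folklore] -/
theorem besselI_zero_eq_mgf_uniform (β : ℝ) :
    besselI 0 β = mgf (fun θ => Real.cos θ)
      ((ENNReal.ofReal (2 * π))⁻¹ • volume.restrict (Ioc (0 : ℝ) (2 * π))) β := by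
  rw [mgf, integral_smul_measure, integral_Ioc_exp_mul_cos, onePlaquetteZ_eq_besselI,
    ENNReal.toReal_inv, ENNReal.toReal_ofReal (by positivity), smul_eq_mul]
  field_simp

/-- The uniform law on `(0, 2π]` is a probability measure. [folklore] -/
theorem isProbabilityMeasure_uniform_Ioc :
    IsProbabilityMeasure ((ENNReal.ofReal (2 * π))⁻¹ • volume.restrict (Ioc (0 : ℝ) (2 * π))) := by
  refine ⟨?_⟩
  rw [Measure.smul_apply, Measure.restrict_apply_univ, Real.volume_Ioc, sub_zero, smul_eq_mul,
    ENNReal.inv_mul_cancel]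
  · exact (ENNReal.ofReal_pos.2 (by positivity)).ne'
  · exact ENNReal.ofReal_ne_top

/-- All exponential moments of `cos` under the uniform law. [folklore] -/
theorem integrable_exp_mul_cos_uniform (t : ℝ) :
    Integrable (fun θ => Real.exp (t * Real.cos θ))
      ((ENNReal.ofReal (2 * π))⁻¹ • volume.restrict (Ioc (0 : ℝ) (2 * π))) :=
  (integrableOn_exp_mul_cos t).smul_measure (ENNReal.inv_ne_top.2 (ENNReal.ofReal_pos.2
    (by positivity)).ne')

/-- **`Var(cos θ) = ½`** under the uniform law on `(0, 2π]` (`∫cos = 0`, `∫cos² = π`). [folklore] -/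
theorem variance_cos_uniform :
    Var[fun θ => Real.cos θ; (ENNReal.ofReal (2 * π))⁻¹ • volume.restrict (Ioc (0 : ℝ) (2 * π))]
      = 1 / 2 := by
  have hπ : (0 : ℝ) ≤ 2 * π := by positivity
  have hmean : ∫ θ, Real.cos θ ∂((ENNReal.ofReal (2 * π))⁻¹ • volume.restrict (Ioc (0 : ℝ) (2 * π)))
      = 0 := by
    rw [integral_smul_measure, ← intervalIntegral.integral_of_le hπ, integral_cos]
    simp
  rw [variance_of_integral_eq_zero Real.continuous_cos.aemeasurable hmean]
  show ∫ θ, Real.cos θ ^ 2 ∂((ENNReal.ofReal (2 * π))⁻¹ • volume.restrict (Ioc (0 : ℝ) (2 * π)))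
    = 1 / 2
  rw [integral_smul_measure, ← intervalIntegral.integral_of_le hπ, integral_cos_sq,
    ENNReal.toReal_inv, ENNReal.toReal_ofReal hπ, smul_eq_mul]
  simp [Real.sin_two_pi, Real.cos_two_pi]
  field_simp

/-- **U(1) STRONG COUPLING, ESS: `(1 − I₀(β)²/I₀(2β))/β² → ½` as `β → 0`.** [ours] -/
theorem tendsto_one_sub_besselI_sq_div_double_div_sq :
    Tendsto (fun β : ℝ => (1 - besselI 0 β ^ 2 / besselI 0 (2 * β)) / β ^ 2) (𝓝[≠] 0)
      (𝓝 (1 / 2)) := by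
  haveI := isProbabilityMeasure_uniform_Ioc
  have h := tendsto_one_sub_mgf_sq_div_double_div_sq integrable_exp_mul_cos_uniform
  rw [variance_cos_uniform] at h
  simpa only [← besselI_zero_eq_mgf_uniform] using h

/-- **U(1) STRONG COUPLING, CEILING: `(1 − I₀(β/2)²/I₀(β))/β² → ⅛` as `β → 0`.** [ours] -/
theorem tendsto_one_sub_besselI_half_sq_div_div_sq :
    Tendsto (fun β : ℝ => (1 - besselI 0 (β / 2) ^ 2 / besselI 0 β) / β ^ 2) (𝓝[≠] 0)
      (𝓝 (1 / 8)) := by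
  haveI := isProbabilityMeasure_uniform_Ioc
  have h := tendsto_one_sub_mgf_half_sq_div_div_sq integrable_exp_mul_cos_uniform
  rw [variance_cos_uniform, show (1 / 2 : ℝ) / 4 = 1 / 8 by norm_num] at h
  simpa only [← besselI_zero_eq_mgf_uniform] using h

end U1

/-! ## §4 Wilson lattice gauge theory under product Haar -/

section Wilson

open Literature.MathematicalPhysics.QuantumFieldTheory

variable {d L N : ℕ} [NeZero L] {G : Type*} [Group G] [TopologicalSpace G] [IsTopologicalGroup G]
  [CompactSpace G] [MeasurableSpace G] [BorelSpace G] (ρ : G →* Matrix (Fin N) (Fin N) ℂ)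

/-- `Z(β) = (partitionFunction ρ β).toReal` is the mgf of `−S` under product Haar (restated in this
file's vocabulary; proof `simp`). [folklore] -/
theorem partitionFunction_toReal_eq_mgf_neg' (hρ : Continuous ρ) (β : ℝ) :
    mgf (fun U => -wilsonAction ρ U) (Measure.pi fun _ : Edge d L => haarProbability G) β
      = (partitionFunction (d := d) (L := L) ρ β).toReal := by
  rw [partitionFunction_toReal_eq_integral ρ hρ]
  simp only [mgf, neg_mul, mul_neg]

/-- **WILSON STRONG COUPLING, ESS: `(1 − Z(β)²/Z(2β))/β² → Var_Haar(S)` as `β → 0`.** [ours] -/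
theorem wilsonIdentityFlow_one_sub_essFrac_div_sq_tendsto (hρ : Continuous ρ) :
    Tendsto (fun β : ℝ => (1 - (partitionFunction (d := d) (L := L) ρ β).toReal ^ 2
        / (partitionFunction (d := d) (L := L) ρ (2 * β)).toReal) / β ^ 2) (𝓝[≠] 0)
      (𝓝 (Var[fun U : GaugeConfig d L G => wilsonAction ρ U;
        Measure.pi fun _ : Edge d L => haarProbability G])) := by
  have hint : ∀ t : ℝ, Integrable (fun U : GaugeConfig d L G => Real.exp (t * -wilsonAction ρ U))
      (Measure.pi fun _ : Edge d L => haarProbability G) := fun t => by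
    simpa only [neg_mul, mul_neg] using integrable_exp_mul_wilsonAction ρ hρ (-t)
      (Measure.pi fun _ : Edge d L => haarProbability G)
  have h := tendsto_one_sub_mgf_sq_div_double_div_sq hint
  rw [variance_fun_neg] at h
  simpa only [partitionFunction_toReal_eq_mgf_neg' ρ hρ] using h

/-- **WILSON STRONG COUPLING, CEILING: `(1 − Z(β/2)²/Z(β))/β² → Var_Haar(S)/4` as `β → 0`.**
[ours] -/
theorem wilsonIdentityFlow_one_sub_bhattSq_div_sq_tendsto (hρ : Continuous ρ) :
    Tendsto (fun β : ℝ => (1 - (partitionFunction (d := d) (L := L) ρ (β / 2)).toReal ^ 2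
        / (partitionFunction (d := d) (L := L) ρ β).toReal) / β ^ 2) (𝓝[≠] 0)
      (𝓝 (Var[fun U : GaugeConfig d L G => wilsonAction ρ U;
        Measure.pi fun _ : Edge d L => haarProbability G] / 4)) := by
  have hint : ∀ t : ℝ, Integrable (fun U : GaugeConfig d L G => Real.exp (t * -wilsonAction ρ U))
      (Measure.pi fun _ : Edge d L => haarProbability G) := fun t => by
    simpa only [neg_mul, mul_neg] using integrable_exp_mul_wilsonAction ρ hρ (-t)
      (Measure.pi fun _ : Edge d L => haarProbability G)
  have h := tendsto_one_sub_mgf_half_sq_div_div_sq hint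
  rw [variance_fun_neg] at h
  simpa only [partitionFunction_toReal_eq_mgf_neg' ρ hρ] using h

end Wilson

end Summit.Ventures.LatticeQCDFlow.Theory2

end
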